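import Summits.QuantumFields.YangMills.Theorems.UnitScaleTiltProp7CombTildRem2HMcomb2T3
import Summits.QuantumFields.YangMills.Theorems.UnitScaleTiltProp7LinearTowerDuhamel
import Summits.QuantumFields.YangMills.Theorems.UnitScaleTiltProp7CombPeriodCellDict
import HarnessLib

/-!
# `UnitScaleTiltProp7CombTildRem2HMcomb2OfCellRowT3` — M-4a OF px18 g4's H2-1(E) MEMBER-KNIT SKELETON (LOCATE 2686e4bb §2, «M-4: the member at `RegPr` over H-3c letters + ✓F-8a»):
# **`hMcomb₂` ⟸ ONE CELL-INDEXED `ℓ¹` ROW OF THE SECOND-ORDER DEFECT AT THE DUHAMEL PROPAGATORS** — the SOCKET the member knit (M-1 ∕ M-2 ∕ M-3-R ✓p714406 ∕ M-3) fills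
(route `UnitScaleTilt`, crux K1 «MinimiserStabilityRegPr» stmt-QuantumFields-19200; (β) row `hMcomb₂` of ✓`Prop7HDOfCombRowRem2Rows.hD_of_hMcomb_of_rem2Rows`; def-free, count-neutral,
`--supports stmt-QuantumFields-19200 --as helper`).  Cell `ym3-torus` (HUMAN RULING D-0037, YM ladder rung R3 — YM₃ on T³ is a rung, not d = 4, not infinite volume, not a mass gap,
not Clay), width seat `ym3-torus-px17` (gen 5; lineage of H-1…H-4b, px17 g4).

WHY.  H-3c ✓`Prop7CombTildRem2HMcomb2T3.hMcomb₂_of_rem2L1` turns px13 g6's displayed row `hMcomb₂` (SIGNATURE-0′) into the `ℓ¹` row `hE` of the second-order defect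
`E_l = (Ũˡ − 1) − Q_l (iX)♯` over the level-`l` TORUS sites, for ANY family `Q` carrying ★routeR-w1's linearised-tower texts `hQ0`∕`hQs`; H-4b reads `E_l` through the DUHAMEL
PROPAGATORS `P l i` of the one-step maps `T_k` (✓`Prop7LinearTowerDuhamel.exists_propagator`: `P i i = id`, `P (l+1) i = T_l ∘ P l i`), and the member knit (px18's M-1, px13's M-2,
★routeR-w3's M-3-R, M-3) prices `Σ_{cell_l}‖E_l‖` in CELL letters (`t : Fin 3 → Fin N_l`, ✓F-8a).  This file is the adapter between the two: (i) the linearised tower IS the propagator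
column `Q_k := P k 0` (its texts `hQ0`∕`hQs` are `hP0`∕`hPs` + the written-out one-step map `hT` — H-4b's letters VERBATIM), (ii) the torus `ℓ¹` sum IS the cell sum
(✓`Prop7CombPeriodCellDict.sum_site_eq_sum_boxVec`; `tlift z = fun μ ↦ (z μ).val` by `rfl`).  So the knit's LAST `exact` targets ONE displayed hypothesis `hEcell` — the level-`l` cell
`ℓ¹` row of `E_l` at `Q := P · 0` — and `hMcomb₂` follows at `RegPr` with NO further torus bookkeeping.

WHAT IS PROVED (ns `…Theorems.Prop7CombTildRem2HMcomb2OfCellRowT3`; sorry-free):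
* `linTower_texts_of_propagator` — for ANY `T` with H-4b's written-out one-step text `hT` and ANY propagator family `(P, hP0, hPs)`: `Q := fun k ↦ P k 0` satisfies H-3c's `hQ0`∕`hQs`;
* ★★★`hMcomb₂_of_cellRow` — at `RegPr F n K ε₀ W` (`10⁷L⁴ε₀ ≤ 1`), for ANY such `(T, hT)`, `(P, hP0, hPs)`: IF `hEcell : ∀ l < K − n, Σ_{t : Fin d → Fin N_l} Σ_κ ‖(↑Ũˡ(boxVec N_l t, κ) − 1) −
  P l 0 (iX)♯ (boxVec N_l t) κ‖ ≤ Am₂·(Lˡ)⁻¹ + Bm₂·Lˡ` (`N_l = (F.P K).sitesPerDir l`; `Ũˡ`, `(iX)♯` in H-4b's `expCfg`∕`transl (basePt F n K)` letters), THEN px13 g6's SIGNATURE-0′ `hMcomb₂` row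
  at `A := iX` — H-3c's conclusion TOKEN FOR TOKEN.
HONEST FRAMING.  A 2-step adapter over H-3c + ✓F-8a (S); the analytic row `hEcell` is DISPLAYED (its suppliers: H-4b + M-1 + M-2 + M-3-R + windows F-8c-3a∕3b + `hMcomb` + (G_j));
nothing of H2-1(E)∕`hMcomb₂`∕`hMcomb`∕(β)∕hPA2∕hcoS∕E′∕EX∕the crux is proved; rung R3, not Clay; the YM mass gap is NOT proved.
References: T. Bałaban, CMP 98 (1985) 17–51 [Balaban1985Averaging] ((65)–(69) p.29, Prop. 3 (113)–(126) pp.34–36, (119) p.35); CMP 99 (1985) 75–102 [Balaban1985RegularSpaces]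
(p.77 «Ω_j = T_η»); CMP 109 (1987) 249–301 [Balaban1987RG1] ((0.1) p.251, (0.4) p.253).
-/

set_option autoImplicit false

noncomputable section

open scoped BigOperators Matrix.Norms.L2Operator

namespace Summit.QuantumFields.YangMills.Theorems.Prop7CombTildRem2HMcomb2OfCellRowT3

open NormedSpace
open Literature.MathematicalPhysics.QuantumFieldTheory.Balaban1983to89
open Literature.MathematicalPhysics.QuantumFieldTheory.Balaban1983to89.T3ContinuumYM3Torus
open T4Continuum BlockAveraging
open T3PrintedRegularMinimiser (RegPr)
open T3SectALandauChart (bgUnits)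
open ExpMeanLog (eml)
open B7Prop1Explicit renaming Site → LSite
open B7Prop1Explicit (e seg boxVec gammaWord Wcx Xavg expUnit)
open B7Prop2Explicit (avgIter)
open B7Prop3Flat (expCfg)
open B7Eq92Concrete (tildIter)
open B7Prop3GeneralRotated (tsum)
open B10Eq27TorusAxialLog (pull transl)
open T4TermwiseTorus (tlift)
open Summit.QuantumFields.YangMills.Theorems.Prop7SPrint (basePt)
open Summit.QuantumFields.YangMills.Theorems.Prop7CombPeriodCellDict (sum_site_eq_sum_boxVec)
open Summit.QuantumFields.YangMills.Theorems.Prop7LinearTowerDuhamel (exists_propagator)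
open Summit.QuantumFields.YangMills.Theorems.Prop7CombTildRem2HMcomb2T3 (hMcomb₂_of_rem2L1)

section Member

variable (F : T3Family) {n K : ℕ}

/-- **THE LINEARISED TOWER IS THE PROPAGATOR COLUMN `Q_k := P k 0`**: for any one-step maps `T_k` with H-4b's written-out text and any Duhamel propagator family `P` (`P i i = id`,
`P (l+1) i = T_l ∘ P l i` for `i ≤ l`), `Q := fun k ↦ P k 0` carries H-3c's texts `hQ0` (`Q 0 = id`) and `hQs` (`Q (k+1) Y (z,κ) = T_k(Q k Y)(L•z, κ)` written out).
[cite: Balaban1985Averaging, Prop. 3 (113)-(119) pp.34-35; Balaban1987RG1, (0.4) p.253] -/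
theorem linTower_texts_of_propagator (W : GaugeField (F.P K) 0 (Matrix.specialUnitaryGroup (Fin 2) ℂ))
    (T : ℕ → (LSite (F.P K).d → Fin (F.P K).d → Matrix (Fin 2) (Fin 2) ℂ) → LSite (F.P K).d → Fin (F.P K).d → Matrix (Fin 2) (Fin 2) ℂ)
    (hT : ∀ (k : ℕ) (f : LSite (F.P K).d → Fin (F.P K).d → Matrix (Fin 2) (Fin 2) ℂ) (z : LSite (F.P K).d) (κ : Fin (F.P K).d),
      letI : CStarAlgebra (Matrix (Fin 2) (Fin 2) ℂ) := B10Eq29TubeLine.cstarAlgebraMatrix 2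
      T k f z κ
        = fderiv ℂ (eml : ((Fin (F.P K).d → Fin (F.P K).L) → Matrix (Fin 2) (Fin 2) ℂ) → Matrix (Fin 2) (Fin 2) ℂ)
              (fun r => ((Wcx (F.P K).L (avgIter (F.P K).L (pull (bgUnits F K W) (basePt F n K)) k) (((F.P K).L : ℤ) • z) κ (boxVec (F.P K).L r) :
                (Matrix (Fin 2) (Fin 2) ℂ)ˣ) : Matrix (Fin 2) (Fin 2) ℂ))
              (fun r => tsum (avgIter (F.P K).L (pull (bgUnits F K W) (basePt F n K)) k) f (((F.P K).L : ℤ) • z)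
                  (gammaWord (F.P K).L κ (boxVec (F.P K).L r) ++ seg κ (-((F.P K).L : ℤ)))
                * ((Wcx (F.P K).L (avgIter (F.P K).L (pull (bgUnits F K W) (basePt F n K)) k) (((F.P K).L : ℤ) • z) κ (boxVec (F.P K).L r) :
                    (Matrix (Fin 2) (Fin 2) ℂ)ˣ) : Matrix (Fin 2) (Fin 2) ℂ))
              * (((expUnit (Xavg (F.P K).L (avgIter (F.P K).L (pull (bgUnits F K W) (basePt F n K)) k) (((F.P K).L : ℤ) • z) κ))⁻¹ :
                  (Matrix (Fin 2) (Fin 2) ℂ)ˣ) : Matrix (Fin 2) (Fin 2) ℂ)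
            + ((expUnit (Xavg (F.P K).L (avgIter (F.P K).L (pull (bgUnits F K W) (basePt F n K)) k) (((F.P K).L : ℤ) • z) κ) : (Matrix (Fin 2) (Fin 2) ℂ)ˣ) :
                  Matrix (Fin 2) (Fin 2) ℂ)
                * tsum (avgIter (F.P K).L (pull (bgUnits F K W) (basePt F n K)) k) f (((F.P K).L : ℤ) • z) (seg κ ((F.P K).L : ℤ))
              * (((expUnit (Xavg (F.P K).L (avgIter (F.P K).L (pull (bgUnits F K W) (basePt F n K)) k) (((F.P K).L : ℤ) • z) κ))⁻¹ :
                  (Matrix (Fin 2) (Fin 2) ℂ)ˣ) : Matrix (Fin 2) (Fin 2) ℂ))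
    (P : ℕ → ℕ → (LSite (F.P K).d → Fin (F.P K).d → Matrix (Fin 2) (Fin 2) ℂ) → LSite (F.P K).d → Fin (F.P K).d → Matrix (Fin 2) (Fin 2) ℂ)
    (hP0 : ∀ i f, P i i f = f) (hPs : ∀ l i f, i ≤ l → P (l + 1) i f = T l (P l i f)) :
    (∀ Y, (fun k => P k 0) 0 Y = Y) ∧
    ∀ (k : ℕ) (Y : LSite (F.P K).d → Fin (F.P K).d → Matrix (Fin 2) (Fin 2) ℂ) (z : LSite (F.P K).d) (κ : Fin (F.P K).d),
      letI : CStarAlgebra (Matrix (Fin 2) (Fin 2) ℂ) := B10Eq29TubeLine.cstarAlgebraMatrix 2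
      (fun k => P k 0) (k + 1) Y z κ
        = fderiv ℂ (eml : ((Fin (F.P K).d → Fin (F.P K).L) → Matrix (Fin 2) (Fin 2) ℂ) → Matrix (Fin 2) (Fin 2) ℂ)
              (fun r => ((Wcx (F.P K).L (avgIter (F.P K).L (pull (bgUnits F K W) (basePt F n K)) k) (((F.P K).L : ℤ) • z) κ (boxVec (F.P K).L r) :
                (Matrix (Fin 2) (Fin 2) ℂ)ˣ) : Matrix (Fin 2) (Fin 2) ℂ))
              (fun r => tsum (avgIter (F.P K).L (pull (bgUnits F K W) (basePt F n K)) k) ((fun k => P k 0) k Y) (((F.P K).L : ℤ) • z)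
                  (gammaWord (F.P K).L κ (boxVec (F.P K).L r) ++ seg κ (-((F.P K).L : ℤ)))
                * ((Wcx (F.P K).L (avgIter (F.P K).L (pull (bgUnits F K W) (basePt F n K)) k) (((F.P K).L : ℤ) • z) κ (boxVec (F.P K).L r) :
                    (Matrix (Fin 2) (Fin 2) ℂ)ˣ) : Matrix (Fin 2) (Fin 2) ℂ))
              * (((expUnit (Xavg (F.P K).L (avgIter (F.P K).L (pull (bgUnits F K W) (basePt F n K)) k) (((F.P K).L : ℤ) • z) κ))⁻¹ :
                  (Matrix (Fin 2) (Fin 2) ℂ)ˣ) : Matrix (Fin 2) (Fin 2) ℂ)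
            + ((expUnit (Xavg (F.P K).L (avgIter (F.P K).L (pull (bgUnits F K W) (basePt F n K)) k) (((F.P K).L : ℤ) • z) κ) : (Matrix (Fin 2) (Fin 2) ℂ)ˣ) :
                  Matrix (Fin 2) (Fin 2) ℂ)
                * tsum (avgIter (F.P K).L (pull (bgUnits F K W) (basePt F n K)) k) ((fun k => P k 0) k Y) (((F.P K).L : ℤ) • z) (seg κ ((F.P K).L : ℤ))
              * (((expUnit (Xavg (F.P K).L (avgIter (F.P K).L (pull (bgUnits F K W) (basePt F n K)) k) (((F.P K).L : ℤ) • z) κ))⁻¹ :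
                  (Matrix (Fin 2) (Fin 2) ℂ)ˣ) : Matrix (Fin 2) (Fin 2) ℂ) := by
  refine ⟨fun Y => hP0 0 Y, fun k Y z κ => ?_⟩
  show P (k + 1) 0 Y z κ = _
  rw [hPs k 0 Y (Nat.zero_le k)]
  exact hT k (P k 0 Y) z κ

/-- ★★★ **`hMcomb₂` ⟸ THE CELL-INDEXED `ℓ¹` ROW OF THE SECOND-ORDER DEFECT AT THE DUHAMEL PROPAGATORS** (the member at `RegPr`, `10⁷L⁴ε₀ ≤ 1`).  For ANY one-step family `T` with
H-4b's written-out text and ANY propagator family `P` (`hP0`, `hPs`): IF, at every level `l < K − n`, the `ℓ¹` norm over ONE PERIOD CELL (`t : Fin d → Fin N_l`, `N_l = (F.P K).sitesPerDir l`)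
of `E_l := (↑Ũˡ − 1) − P l 0 (iX)♯` is `≤ Am₂·(Lˡ)⁻¹ + Bm₂·Lˡ` — the row the member knit M-1∕M-2∕M-3-R∕M-3 supplies from H-4b's Duhamel split, `hMcomb` per level and (G_j) — THEN px13 g6's
SIGNATURE-0′ row `hMcomb₂` holds at `A := iX` (H-3c ✓`hMcomb₂_of_rem2L1` at `Q := P · 0` ∘ ✓F-8a `sum_site_eq_sum_boxVec`).
[cite: Balaban1985Averaging, (65)-(69) p.29, Prop. 3 (113)-(126) pp.34-36; Balaban1985RegularSpaces, p.77; Balaban1987RG1, (0.1) p.251, (0.4) p.253] -/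
theorem hMcomb₂_of_cellRow {ε₀ : ℝ} (hε₀ : 0 < ε₀) (hε : 10 ^ 7 * (F.L : ℝ) ^ 4 * ε₀ ≤ 1)
    (W : GaugeField (F.P K) 0 (Matrix.specialUnitaryGroup (Fin 2) ℂ)) (hreg : RegPr F n K ε₀ W) (X : PBond (F.P K) 0 → Matrix (Fin 2) (Fin 2) ℂ)
    (T : ℕ → (LSite (F.P K).d → Fin (F.P K).d → Matrix (Fin 2) (Fin 2) ℂ) → LSite (F.P K).d → Fin (F.P K).d → Matrix (Fin 2) (Fin 2) ℂ)
    (hT : ∀ (k : ℕ) (f : LSite (F.P K).d → Fin (F.P K).d → Matrix (Fin 2) (Fin 2) ℂ) (z : LSite (F.P K).d) (κ : Fin (F.P K).d),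
      letI : CStarAlgebra (Matrix (Fin 2) (Fin 2) ℂ) := B10Eq29TubeLine.cstarAlgebraMatrix 2
      T k f z κ
        = fderiv ℂ (eml : ((Fin (F.P K).d → Fin (F.P K).L) → Matrix (Fin 2) (Fin 2) ℂ) → Matrix (Fin 2) (Fin 2) ℂ)
              (fun r => ((Wcx (F.P K).L (avgIter (F.P K).L (pull (bgUnits F K W) (basePt F n K)) k) (((F.P K).L : ℤ) • z) κ (boxVec (F.P K).L r) :
                (Matrix (Fin 2) (Fin 2) ℂ)ˣ) : Matrix (Fin 2) (Fin 2) ℂ))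
              (fun r => tsum (avgIter (F.P K).L (pull (bgUnits F K W) (basePt F n K)) k) f (((F.P K).L : ℤ) • z)
                  (gammaWord (F.P K).L κ (boxVec (F.P K).L r) ++ seg κ (-((F.P K).L : ℤ)))
                * ((Wcx (F.P K).L (avgIter (F.P K).L (pull (bgUnits F K W) (basePt F n K)) k) (((F.P K).L : ℤ) • z) κ (boxVec (F.P K).L r) :
                    (Matrix (Fin 2) (Fin 2) ℂ)ˣ) : Matrix (Fin 2) (Fin 2) ℂ))
              * (((expUnit (Xavg (F.P K).L (avgIter (F.P K).L (pull (bgUnits F K W) (basePt F n K)) k) (((F.P K).L : ℤ) • z) κ))⁻¹ :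
                  (Matrix (Fin 2) (Fin 2) ℂ)ˣ) : Matrix (Fin 2) (Fin 2) ℂ)
            + ((expUnit (Xavg (F.P K).L (avgIter (F.P K).L (pull (bgUnits F K W) (basePt F n K)) k) (((F.P K).L : ℤ) • z) κ) : (Matrix (Fin 2) (Fin 2) ℂ)ˣ) :
                  Matrix (Fin 2) (Fin 2) ℂ)
                * tsum (avgIter (F.P K).L (pull (bgUnits F K W) (basePt F n K)) k) f (((F.P K).L : ℤ) • z) (seg κ ((F.P K).L : ℤ))
              * (((expUnit (Xavg (F.P K).L (avgIter (F.P K).L (pull (bgUnits F K W) (basePt F n K)) k) (((F.P K).L : ℤ) • z) κ))⁻¹ :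
                  (Matrix (Fin 2) (Fin 2) ℂ)ˣ) : Matrix (Fin 2) (Fin 2) ℂ))
    (P : ℕ → ℕ → (LSite (F.P K).d → Fin (F.P K).d → Matrix (Fin 2) (Fin 2) ℂ) → LSite (F.P K).d → Fin (F.P K).d → Matrix (Fin 2) (Fin 2) ℂ)
    (hP0 : ∀ i f, P i i f = f) (hPs : ∀ l i f, i ≤ l → P (l + 1) i f = T l (P l i f))
    {Am₂ Bm₂ : ℝ}
    (hEcell : ∀ l : ℕ, l < K - n →
      ∑ t : Fin (F.P K).d → Fin ((F.P K).sitesPerDir l), ∑ κ : Fin (F.P K).d,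
        ‖(((tildIter (F.P K).L (pull (bgUnits F K W) (basePt F n K)) (expCfg fun x μ => Complex.I • X ⟨transl (basePt F n K) x, μ⟩) l
              (boxVec ((F.P K).sitesPerDir l) t) κ : (Matrix (Fin 2) (Fin 2) ℂ)ˣ) : Matrix (Fin 2) (Fin 2) ℂ) - 1)
            - P l 0 (fun x μ => Complex.I • X ⟨transl (basePt F n K) x, μ⟩) (boxVec ((F.P K).sitesPerDir l) t) κ‖
          ≤ Am₂ * ((F.L : ℝ) ^ l)⁻¹ + Bm₂ * (F.L : ℝ) ^ l) :
    ∀ l : ℕ, l < K - n →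
      ∑ z : Site (F.P K) l, ∑ κ : Fin (F.P K).d,
        ‖((tildIter (F.P K).L (pull (bgUnits F K W) (basePt F n K)) (pull (fun b => expUnit ((fun b => Complex.I • X b) b)) (basePt F n K)) l
              (fun μ => ((z μ).val : ℤ)) κ : (Matrix (Fin 2) (Fin 2) ℂ)ˣ) : Matrix (Fin 2) (Fin 2) ℂ) - 1
            - (fderiv ℂ (fun A' : PBond (F.P K) 0 → Matrix (Fin 2) (Fin 2) ℂ =>
                ((tildIter (F.P K).L (pull (bgUnits F K W) (basePt F n K)) (pull (fun b => expUnit (A' b)) (basePt F n K)) l (fun μ => ((z μ).val : ℤ)) κ :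
                  (Matrix (Fin 2) (Fin 2) ℂ)ˣ) : Matrix (Fin 2) (Fin 2) ℂ)) 0) (fun b => Complex.I • X b)‖
          ≤ Am₂ * ((F.L : ℝ) ^ l)⁻¹ + Bm₂ * (F.L : ℝ) ^ l := by
  obtain ⟨hQ0, hQs⟩ := linTower_texts_of_propagator F (n := n) W T hT P hP0 hPs
  refine hMcomb₂_of_rem2L1 F hε₀ hε W hreg X (fun k => P k 0) hQ0 hQs (fun l hl => ?_)
  -- the torus `ℓ¹` sum is the period-cell sum (`tlift z = fun μ ↦ (z μ).val` by `rfl`)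
  have hcell := sum_site_eq_sum_boxVec (P := F.P K) (l := l) (N := (F.P K).sitesPerDir l) rfl
    (fun x => ∑ κ : Fin (F.P K).d,
      ‖(((tildIter (F.P K).L (pull (bgUnits F K W) (basePt F n K)) (expCfg fun x μ => Complex.I • X ⟨transl (basePt F n K) x, μ⟩) l x κ :
            (Matrix (Fin 2) (Fin 2) ℂ)ˣ) : Matrix (Fin 2) (Fin 2) ℂ) - 1)
          - P l 0 (fun x μ => Complex.I • X ⟨transl (basePt F n K) x, μ⟩) x κ‖)
  calc _ = ∑ z : Site (F.P K) l, ∑ κ : Fin (F.P K).d,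
        ‖(((tildIter (F.P K).L (pull (bgUnits F K W) (basePt F n K)) (expCfg fun x μ => Complex.I • X ⟨transl (basePt F n K) x, μ⟩) l (tlift z) κ :
            (Matrix (Fin 2) (Fin 2) ℂ)ˣ) : Matrix (Fin 2) (Fin 2) ℂ) - 1)
          - P l 0 (fun x μ => Complex.I • X ⟨transl (basePt F n K) x, μ⟩) (tlift z) κ‖ := Finset.sum_congr rfl fun z _ => rfl
    _ = _ := hcell
    _ ≤ _ := hEcell l hl

end Member

end Summit.QuantumFields.YangMills.Theorems.Prop7CombTildRem2HMcomb2OfCellRowT3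

end
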